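import Summits.AtomisticToContinuum.Crystallization.Theorems.IsometryAtomsMinimisingLawsHaveAtomsOfStrictCalibration
import Summits.AtomisticToContinuum.Crystallization.Theorems.ThreeConeCertificateSlackRigidityPricedFloorsReadoff
import Summits.AtomisticToContinuum.Crystallization.Theorems.PalmUnimodularRigidityBenjaminiSchrammLimit
import Summits.AtomisticToContinuum.Crystallization.Theorems.ChargedEnergyGap.Negative.Unconditional

/-!
# What the content stub of line `IdeatorOneSketch` CONTAINS (crux `IsometryAtoms.MinimisingLawsHaveAtoms`,
# stmt-AtomisticToContinuum-15776): a strict hcp calibration already gives conjunct (i) of the summit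

Kernel-checked calibration of the size of the one remaining registered stub
`stub_strictCalibrationHcp` (for every hard core `δ > 0` a strict finite-hop Mecke calibration at a
box template `hcpStacking a h`, exact at radius `11a/5`):

* `exists_minimising_law` — the frame of the crux is inhabited WITH EQUALITY: the Benjamini–Schramm
  limit law of a sequence of Lennard-Jones ground states (`benjaminiSchrammLimit_proof`, item 9230)
  is a point-stationary, a.s. `δ`-hard-core probability law with `E_P[h] = e* = ⨅_Q e(Q)`
  (`ChargedEnergyGapNegative.crysEnergyLimit`, item 0626; `LennardJonesGroundStatesExist_holds`).
  (Re-derivation of the refuter's non-vacuity witness, needed as a lemma here.)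
* `hcp_attains_iInf_of_strictCalibrationHcp` — under the stub, fed with that law: a.s. the sample
  is a rooted copy of `hcpStacking a h` (landed reduction file: first lemma, exact local theorem for
  hcp, second lemma), its root energy is `e(hcp a h)` (`rootEnergy_image_hcpStacking`, vertex
  transitivity of hcp), hence `e(hcp a h) = E_P[h] = e*`: relaxed hcp with box parameters ATTAINS
  the infimum of the energy per particle over all periodic configurations of `ℝ³`.
* `hasPeriodicGroundStateEnergy_of_strictCalibrationHcp` — consequently
  `HasPeriodicGroundStateEnergy lennardJones 3`, the FIRST CONJUNCT of the summit statement
  `Crystallization` (attained periodic minimum + `E(N)/N → min`, with `crysEnergyLimit` and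
  `eStar_le`), follows from the stub ALONE. The stub is therefore at least conjunct-(i)-sized
  (the optimality of hcp for `V_LJ` in `d = 3`, open: Blanc–Lewin 2015 §2.3) — the line's
  `promote-stub` evidence.
-/

noncomputable section

open MeasureTheory Filter
open Literature.Probability.Process (IsPointStationaryLaw IsRootedHardCore)
open Literature.MathematicalPhysics.StatisticalMechanics (lennardJones rootEnergy PeriodicConfiguration
  hcpStacking hcpStacking_homogeneous hcpPeriodicConfiguration groundStateEnergy IsGroundState
  HasPeriodicGroundStateEnergy LennardJonesGroundStatesExist_holds)

namespace Summit.AtomisticToContinuum.Crystallization.Theorems.IsometryAtomsMinimisingLawsHaveAtoms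

/-- **The frame of the crux is inhabited, with equality in the minimising hypothesis.** There are a
hard core `δ > 0` and a point-stationary probability law on rooted configurations of `ℝ³`, almost
surely `δ`-hard-core, whose mean root energy EQUALS `e* = ⨅_Q e(Q)`: the Benjamini–Schramm limit of
a sequence of Lennard-Jones ground states (`benjaminiSchrammLimit_proof`), along which
`E(φ j)/φ j → E_P[h]`, while `E(N)/N → e*` (`crysEnergyLimit`). [folklore; AldousLyons2007 §2,
BlancLewin2015 §2.1] -/
theorem exists_minimising_law : ∃ δ : ℝ, 0 < δ ∧
    ∃ P : Measure (Measure (EuclideanSpace ℝ (Fin 3))), IsProbabilityMeasure P ∧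
      (∀ᵐ μ ∂P, IsRootedHardCore δ μ) ∧ IsPointStationaryLaw P ∧
      (∫ μ, rootEnergy lennardJones μ ∂P) =
        ⨅ Q : PeriodicConfiguration 3, Q.energyPerParticle lennardJones := by
  choose x hx using
    (show ∀ N : ℕ, ∃ y : Fin N → EuclideanSpace ℝ (Fin 3), IsGroundState lennardJones y from
      LennardJonesGroundStatesExist_holds)
  obtain ⟨φ, hφ, δ, hδ, P, hP, hhc, hst, htend, -⟩ :=
    Summit.AtomisticToContinuum.Crystallization.Theorems.benjaminiSchrammLimit_proof x hx
  refine ⟨δ, hδ, P, hP, hhc, hst, ?_⟩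
  have h1 : Tendsto (fun j : ℕ => groundStateEnergy lennardJones 3 (φ j) / (φ j : ℝ)) atTop
      (nhds (⨅ Q : PeriodicConfiguration 3, Q.energyPerParticle lennardJones)) :=
    ChargedEnergyGapNegative.crysEnergyLimit.comp hφ.tendsto_atTop
  exact tendsto_nhds_unique htend h1

/-- **A strict hcp calibration makes relaxed hcp ATTAIN `e*`.** Under the content stub
`stub_strictCalibrationHcp` of line `IdeatorOneSketch` (verbatim as hypothesis): feeding it the
minimising law of `exists_minimising_law`, almost every sample is a rooted isometric copy of
`hcpStacking a h` (`ae_exactEnv_of_strictCalibration`, `locallyRigid_hcpStacking`,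
`ae_rooted_of_ae_exactEnv`), whose root energy is `e(hcp a h)`
(`SlackRigidityPricedFloorsReadoff.rootEnergy_image_hcpStacking`); integrating,
`e(hcp a h) = E_P[h] = ⨅_Q e(Q)`. -/
theorem hcp_attains_iInf_of_strictCalibrationHcp
    (hcal : ∀ δ : ℝ, 0 < δ → ∃ a h : ℝ, 0 < a ∧ 39 / 50 * a ≤ h ∧ h ≤ 17 / 20 * a ∧
      ∃ (R M : ℝ) (t : Measure (EuclideanSpace ℝ (Fin 3)) → EuclideanSpace ℝ (Fin 3) → ℝ),
        Measurable (Function.uncurry t) ∧ (∀ μ y, |t μ y| ≤ M) ∧ (∀ μ y, R < ‖y‖ → t μ y = 0) ∧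
        (∀ μ : Measure (EuclideanSpace ℝ (Fin 3)), IsRootedHardCore δ μ →
          (⨅ Q : PeriodicConfiguration 3, Q.energyPerParticle lennardJones) ≤
            rootEnergy lennardJones μ +
              ∫ y, (t μ y - t (Measure.map (fun z => z - y) μ) (-y)) ∂μ) ∧
        (∀ μ : Measure (EuclideanSpace ℝ (Fin 3)), IsRootedHardCore δ μ →
          rootEnergy lennardJones μ +
              ∫ y, (t μ y - t (Measure.map (fun z => z - y) μ) (-y)) ∂μ =
            (⨅ Q : PeriodicConfiguration 3, Q.energyPerParticle lennardJones) →
          ∃ ν ∈ {μ : Measure (EuclideanSpace ℝ (Fin 3)) |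
              ∃ A : EuclideanSpace ℝ (Fin 3) →ₗᵢ[ℝ] EuclideanSpace ℝ (Fin 3),
                ∃ q ∈ hcpStacking a h,
                  μ = (Measure.count : Measure (EuclideanSpace ℝ (Fin 3))).restrict
                    ((fun s => A (s - q)) '' hcpStacking a h)},
            μ.restrict (Metric.closedBall (0 : EuclideanSpace ℝ (Fin 3)) (11 / 5 * a)) =
              ν.restrict (Metric.closedBall (0 : EuclideanSpace ℝ (Fin 3)) (11 / 5 * a)))) :
    ∃ a h : ℝ, ∃ (ha : a ≠ 0) (hh : h ≠ 0), 39 / 50 * a ≤ h ∧ h ≤ 17 / 20 * a ∧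
      (hcpPeriodicConfiguration ha hh).energyPerParticle lennardJones =
        ⨅ Q : PeriodicConfiguration 3, Q.energyPerParticle lennardJones := by
  obtain ⟨δ, hδ, P, hP, hhc, hst, hE⟩ := exists_minimising_law
  obtain ⟨a, h, ha, hh₁, hh₂, R, M, t, ht, hM, hR, hweak, hstrict⟩ := hcal δ hδ
  have ha0 : a ≠ 0 := ha.ne'
  have hh0 : h ≠ 0 := by
    intro h0
    rw [h0] at hh₁
    linarith
  have hae := ae_rooted_of_ae_exactEnv δ (11 / 5 * a) hδ (hcpStacking a h)
    (locallyRigid_hcpStacking a h ha hh₁ hh₂) P hhc hst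
    (ae_exactEnv_of_strictCalibration δ (11 / 5 * a) hδ (hcpStacking a h) R M t ht hM hR hweak
      hstrict P hhc hst hE.le)
  have hconst : ∀ᵐ μ ∂P, rootEnergy lennardJones μ =
      (hcpPeriodicConfiguration ha0 hh0).energyPerParticle lennardJones := by
    filter_upwards [hae] with μ hμ
    obtain ⟨A, q, hq, rfl⟩ := hμ
    obtain ⟨B, hB⟩ := hcpStacking_homogeneous a h hq
    rw [rooted_image_eq A B hB]
    exact SlackRigidityPricedFloorsReadoff.rootEnergy_image_hcpStacking ha0 hh0 _
  have hint : (∫ μ, rootEnergy lennardJones μ ∂P) =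
      (hcpPeriodicConfiguration ha0 hh0).energyPerParticle lennardJones := by
    rw [integral_congr_ae hconst, integral_const, smul_eq_mul, probReal_univ, one_mul]
  exact ⟨a, h, ha0, hh0, hh₁, hh₂, hint.symm.trans hE⟩

/-- **The content stub already yields conjunct (i) of the summit statement `Crystallization`.**
Under `stub_strictCalibrationHcp` (verbatim as hypothesis): `HasPeriodicGroundStateEnergy
lennardJones 3` — the Lennard-Jones energy per particle has an ATTAINED minimum over periodic
configurations of `ℝ³` (relaxed hcp, `hcp_attains_iInf_of_strictCalibrationHcp`; lower bound
`ChargedEnergyGapNegative.eStar_le`) and `E(N)/N` converges to it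
(`ChargedEnergyGapNegative.crysEnergyLimit`). Calibrates the stub as at least conjunct-(i)-sized
(optimality of hcp for `V_LJ` in `d = 3`: open, Blanc–Lewin 2015 §2.3). -/
theorem hasPeriodicGroundStateEnergy_of_strictCalibrationHcp :
    (∀ δ : ℝ, 0 < δ → ∃ a h : ℝ, 0 < a ∧ 39 / 50 * a ≤ h ∧ h ≤ 17 / 20 * a ∧ ∃ (R M : ℝ) (t : MeasureTheory.Measure (EuclideanSpace ℝ (Fin 3)) → EuclideanSpace ℝ (Fin 3) → ℝ), Measurable (Function.uncurry t) ∧ (∀ μ y, |t μ y| ≤ M) ∧ (∀ μ y, R < ‖y‖ → t μ y = 0) ∧ (∀ μ : MeasureTheory.Measure (EuclideanSpace ℝ (Fin 3)), Literature.Probability.Process.IsRootedHardCore δ μ → (⨅ Q : Literature.MathematicalPhysics.StatisticalMechanics.PeriodicConfiguration 3, Q.energyPerParticle Literature.MathematicalPhysics.StatisticalMechanics.lennardJones) ≤ Literature.MathematicalPhysics.StatisticalMechanics.rootEnergy Literature.MathematicalPhysics.StatisticalMechanics.lennardJones μ + ∫ y, (t μ y - t (MeasureTheory.Measure.map (fun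 z => z - y) μ) (-y)) ∂μ) ∧ (∀ μ : MeasureTheory.Measure (EuclideanSpace ℝ (Fin 3)), Literature.Probability.Process.IsRootedHardCore δ μ → Literature.MathematicalPhysics.StatisticalMechanics.rootEnergy Literature.MathematicalPhysics.StatisticalMechanics.lennardJones μ + ∫ y, (t μ y - t (MeasureTheory.Measure.map (fun z => z - y) μ) (-y)) ∂μ = (⨅ Q : Literature.MathematicalPhysics.StatisticalMechanics.PeriodicConfiguration 3, Q.energyPerParticle Literature.MathematicalPhysics.StatisticalMechanics.lennardJones) → ∃ ν ∈ {μ : MeasureTheory.Measure (EuclideanSpace ℝ (Fin 3)) | ∃ A : EuclideanSpace ℝ (Fin 3) →ₗᵢ[ℝ] EuclideanSpace ℝ (Fin 3), ∃ q ∈ Literature.MathematicalPhysics.StatisticalMechanics.hcpStacking a h, μ = (MeasureTheory.Measure.count : MeasureTheory.Measure (EuclideanSpace ℝ (Fin 3))).restrict ((fun s => A (s - q)) '' Literature.MathematicalPhysics.StatisticalMechanics.hcpStacking a h)}, μ.restrict (Metric.closedBall (0 : EuclideanSpace ℝ (Fin 3)) (11 / 5 * a)) = ν.restrict (Metric.closedBall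 (0 : EuclideanSpace ℝ (Fin 3)) (11 / 5 * a)))) → Literature.MathematicalPhysics.StatisticalMechanics.HasPeriodicGroundStateEnergy Literature.MathematicalPhysics.StatisticalMechanics.lennardJones 3 := by
  intro hcal
  obtain ⟨a, h, ha, hh, -, -, heq⟩ := hcp_attains_iInf_of_strictCalibrationHcp hcal
  refine ⟨hcpPeriodicConfiguration ha hh, ⟨Set.mem_range_self _, ?_⟩, ?_⟩
  · rintro _ ⟨Q, rfl⟩
    rw [heq]
    exact ChargedEnergyGapNegative.eStar_le Q
  · rw [heq]
    exact ChargedEnergyGapNegative.crysEnergyLimit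

end Summit.AtomisticToContinuum.Crystallization.Theorems.IsometryAtomsMinimisingLawsHaveAtoms

end
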